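import Summits.QuantumFields.YangMills.Theses.FradkinShenkerFlow
import Summits.QuantumFields.YangMills.Theses.CertificationLength
import Summits.QuantumFields.YangMills.Theorems.OneCertifiedCubeFiniteSizeCriterion
import Summits.QuantumFields.YangMills.Theorems.FradkinShenkerFlowFiniteSusceptibilityWeakCouplingCAFunnelCore
import HarnessLib

/-!
# `FiniteSusceptibilityWeakCoupling` — funnel entry from complete analyticity at large scales (item 16178)

Crux `stmt-QuantumFields-9442` (`FradkinShenkerFlow.FiniteSusceptibilityWeakCoupling`, line
`sup-axis-reflection-transfer`). Companion of `…CAFunnelCore`: discharges its two hypotheses by EXISTING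
declarations — the criterion hypothesis by the tree's proof `FiniteSizeCriterion_proof` (item 8895, closed),
and the finite-size hypothesis by item `stmt-QuantumFields-16178`
(`CertificationLength.CompleteAnalyticityAtLargeScales`, frame bound `B = 1`; the item fixes the Borel
σ-algebra `borel G`, an arbitrary `[BorelSpace G]` structure is rewritten to it by `BorelSpace.measurable_eq`).
Result: `CompleteAnalyticityAtLargeScales → FiniteSusceptibilityWeakCoupling` — the weak-coupling infrared
input of this route follows from a Dobrushin–Shlosman finite-size condition at one certifying scale per
coupling (a hypothesis of a different kind from the lattice-gap legs 8778 / 8901 / 8761 / 8715 of `…SiblingFunnel`).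

References: R. L. Dobrushin, S. B. Shlosman, *Completely analytical Gibbs fields* (Birkhäuser 1985), §2;
F. Martinelli, *Lectures on Glauber dynamics for discrete spin models*, LNM 1717 (1999), §2.3.
-/

set_option autoImplicit false

noncomputable section

open MeasureTheory
open Literature.MathematicalPhysics.QuantumFieldTheory hiding Site ZdEdge
open Literature.MathematicalPhysics.QuantumLattice

namespace Summit.QuantumFields.YangMills.Theorems.FiniteSusceptibilityWeakCoupling

/-- **Complete analyticity at large scales ⇒ crux** (attachment of item `stmt-QuantumFields-16178`):
`CertificationLength.CompleteAnalyticityAtLargeScales` implies `FradkinShenkerFlow.FiniteSusceptibilityWeakCoupling`,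
through the proved `OneCertifiedCube.FiniteSizeCriterion` and the landed RP funnel
(`finiteSusceptibilityWeakCoupling_of_finiteSizeConditionAtLargeBeta`). -/
theorem finiteSusceptibilityWeakCoupling_of_completeAnalyticityAtLargeScales
    (h : Summit.QuantumFields.YangMills.Theses.CertificationLength.CompleteAnalyticityAtLargeScales) :
    Summit.QuantumFields.YangMills.Theses.FradkinShenkerFlow.FiniteSusceptibilityWeakCoupling := by
  refine finiteSusceptibilityWeakCoupling_of_finiteSizeConditionAtLargeBeta FiniteSizeCriterion_proof
    fun G _ _ _ _ iM iB hG r => ?_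
  have hM : iM = borel G := BorelSpace.measurable_eq
  subst hM
  obtain ⟨n, ε, hn, hε, hεM, hB⟩ := h G hG r
  obtain ⟨β₂, hβ₂⟩ := hB 1
  refine ⟨n, ε, hn, hε, hεM, β₂, fun β hβ => ?_⟩
  obtain ⟨b, -, hb1, hTV⟩ := hβ₂ β hβ
  exact ⟨b, hb1, hTV⟩

/-- **Registered form** (stub `stub_cruxOfCompleteAnalyticityAtLargeScales` of item stmt-QuantumFields-9442): hypothesis the decl of
item 16178 by name, conclusion the crux by name. -/
theorem stub_cruxOfCompleteAnalyticityAtLargeScales : Summit.QuantumFields.YangMills.Theses.CertificationLength.CompleteAnalyticityAtLargeScales → Summit.QuantumFields.YangMills.Theses.FradkinShenkerFlow.FiniteSusceptibilityWeakCoupling :=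
  finiteSusceptibilityWeakCoupling_of_completeAnalyticityAtLargeScales

end Summit.QuantumFields.YangMills.Theorems.FiniteSusceptibilityWeakCoupling

end
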